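import Summits.Ventures.HSemireg.WedgeHankelRecurrenceDual
import Summits.Ventures.HSemireg.WedgeHankelRecurrenceCensusDet
import Mathlib.RingTheory.AdjoinRoot
import Mathlib.RingTheory.Norm.Defs

/-!
# Venture HSemireg — THE HANKEL DETERMINANT OF A RATIONAL CLASS (Kronecker 1881 ∕ Hermite; Barnett's factorisation): for `m` monic of degree `d = t + 1` and any `a`, the square Hankel matrix
# `(q_{i+j})_{i,j ≤ t}` of the dual class `q = dualSeq m a` (the moments `[X^{d−1}](X^j a mod m)` of `a/m`) **factors as `H(charSeq m) · M_a`**, `M_a` the matrix of multiplication by `a` on the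
# residues modulo `m` in the monomial basis, `H(charSeq m)` anti-unitriangular; hence **`det H = sign(reversal) · det M_a = sign(reversal) · Norm_{K[X]/(m) ∕ K}(a)`**, and
# **`det H ≠ 0 ⟺ gcd(m, a) = 1`**

HONEST FRAMING. Part of the Lean index of the computation cell `pub-hsemireg` (seat p10 gen 30, Sunday typer «UNIFORM-IN-n»).
LINEAR ALGEBRA OF HANKEL (catalecticant) MATRICES and of polynomials over a field ONLY (`Polynomial.modByMonic`, `AdjoinRoot`, `Algebra.norm`): no variety, no cohomology theory, no sheaf,
no Ext group and no semiregularity map is constructed here; nothing here says that HC / HC_CM / HC_AV holds; no Literature fact is declared or used.  Custodian versions as in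
`WedgeHankelSiegelIdeal` (1/3); the dictionary («`det H_{d−1}(a/m) = ± Res(m, a)` for monic `m`», Kronecker 1881, Hermite 1856, Barnett 1983 — the norm `N_{K[X]/(m)/K}(a)` IS the resultant
`Res(m, a)` for monic `m`, a link NOT typed here) is QUOTED in docstrings, never asserted.

WHAT IS IN THE TREE.  N32 (`WedgeHankelRecurrenceDual`, № 263): `dualSeq` (`dualSeq m a j = [X^{d−1}](X^j a mod m)`), `dualSeq_eq_hkFun_charSeq`, `dualSeq_modByMonic`, `dualSeq_X_pow_mul`,
`mem_recSpace_dualSeq_iff`, `rank_hankel1_half_dualSeq_lt_of_not_isCoprime`; N26 (№ 179) `charSeq`, `hkFun_charSeq`; N48 (`WedgeHankelRecurrenceCensusDet`, № 330): `hankelSq`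
(`(q_{i+j})_{i,j ≤ t}`), `rank_hankelSq`, `rank_hankelSq_eq_iff_det_ne_zero`; N18 (№ 173) `hkFun_eq_sum_range`, `finrank_recSpace_add_rank`, `mem_degreeLT_succ_iff`.  Mathlib: `Matrix.det_mul`,
`Matrix.det_permute'`, `Matrix.det_of_lowerTriangular`, `Fin.revPerm`, `Polynomial.modByMonic_eq_self_iff`, `Polynomial.natDegree_modByMonic_lt`, `AdjoinRoot.powerBasisAux'` /
`powerBasisAux'_repr_apply_to_fun`, `Algebra.norm_eq_matrix_det`, `Algebra.leftMulMatrix_eq_repr_mul`, `Basis.repr_symm_single_one`, `Matrix.det_reindex_self`.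
THIS FILE (namespace `Summit.Ventures.HSemireg.Wedge.HankelOuter` continued; PLAIN on N32 + N48 (+ `Mathlib.RingTheory.AdjoinRoot`, `Mathlib.RingTheory.Norm.Defs`); 1 definition `mulResidueMat`):
* §625 `mulResidueMat t m a` (`(M_a)_{k j} = [X^k](X^j · a mod m)`, `k, j ≤ t`); `hankelSq_charSeq_apply_of_lt` ∕ `_of_eq` (`H(charSeq m)_{ij} = 0` for `i + j < t`, `= 1` for `i + j = t`, `deg m = t + 1`),
  **`det_hankelSq_charSeq`** (`det H(charSeq m) = sign(revPerm)`: anti-unitriangular).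
* §626 BARNETT'S FACTORISATION **`hankelSq_dualSeq_eq_mul`** (`H(dualSeq m a) = H(charSeq m) · M_a`), **`det_hankelSq_dualSeq`** (`det H(dualSeq m a) = sign(revPerm) · det M_a`).
* §627 **`det_hankelSq_dualSeq_ne_zero_iff`** (`det H(dualSeq m a) ≠ 0 ⟺ IsCoprime m a`, via N32's recurrence space `{p : deg p ≤ t, m ∣ p a}` and N48's rank ∕ det bridge),
  `det_mulResidueMat_ne_zero_iff` (`det M_a ≠ 0 ⟺ IsCoprime m a`).
* §628 THE NORM: **`det_mulResidueMat_eq_norm`** (`det M_a = Algebra.norm K (AdjoinRoot.mk m a)`), **`det_hankelSq_dualSeq_eq_sign_mul_norm`**, `norm_adjoinRoot_mk_ne_zero_iff` (`⟺ IsCoprime m a`).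
Nothing Ext-side.  New names only.
-/

open Module Polynomial
open scoped Matrix Polynomial

namespace Summit.Ventures.HSemireg.Wedge.HankelOuter

open Summit.Ventures.HSemireg.Wedge Summit.Ventures.HSemireg.Wedge.Hankel

variable (K : Type*) [Field K] {N : ℕ}

/-! ## §625. The multiplication matrix and the anti-unitriangular Hankel matrix of `charSeq m` -/

/-- THE MULTIPLICATION MATRIX `M_a` modulo `m` in the monomial basis, truncated to `(t + 1) × (t + 1)`: `(M_a)_{k j} = [X^k](X^j · a mod m)` (for `deg m = t + 1` the `j`-th column is the
coefficient vector of the residue of `X^j a`). [definition of this file] -/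
noncomputable def mulResidueMat (t : ℕ) (m a : K[X]) : Matrix (Fin (t + 1)) (Fin (t + 1)) K := Matrix.of fun k j => (Polynomial.X ^ (j : ℕ) * a %ₘ m).coeff (k : ℕ)

/-- entries. -/
theorem mulResidueMat_apply (t : ℕ) (m a : K[X]) (k j : Fin (t + 1)) : mulResidueMat K t m a k j = (Polynomial.X ^ (j : ℕ) * a %ₘ m).coeff (k : ℕ) := rfl

/-- `charSeq m n = 0` for `n < t` and `charSeq m t = 1` when `deg m = t + 1` (`X^n mod m = X^n`). -/
theorem charSeq_apply_of_le {t : ℕ} {m : K[X]} (hm : m.Monic) (hmd : m.natDegree = t + 1) {n : ℕ} (hn : n ≤ t) : charSeq K m n = if n = t then 1 else 0 := by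
  have hself : Polynomial.X ^ n %ₘ m = Polynomial.X ^ n := (Polynomial.modByMonic_eq_self_iff hm).mpr (by
    rw [Polynomial.degree_X_pow, Polynomial.degree_eq_natDegree hm.ne_zero, hmd]; exact_mod_cast Nat.lt_succ_of_le hn)
  rw [charSeq, hself, Polynomial.coeff_X_pow, hmd, Nat.add_sub_cancel]
  by_cases h : n = t
  · subst h; simp
  · rw [if_neg (fun h' => h h'.symm), if_neg h]

/-- `H(charSeq m)_{ij} = 0` above the anti-diagonal (`i + j < t`) and `= 1` on it (`i + j = t`). -/
theorem hankelSq_charSeq_apply_of_le {t : ℕ} {m : K[X]} (hm : m.Monic) (hmd : m.natDegree = t + 1) (i j : Fin (t + 1)) (hij : (i : ℕ) + j ≤ t) :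
    hankelSq K t (charSeq K m) i j = if (i : ℕ) + j = t then 1 else 0 := by
  rw [hankelSq, Matrix.of_apply, charSeq_apply_of_le K hm hmd hij]

/-- **`det H(charSeq m) = sign(reversal)`** (`deg m = t + 1`): reversing the columns gives a lower unitriangular matrix. -/
theorem det_hankelSq_charSeq {t : ℕ} {m : K[X]} (hm : m.Monic) (hmd : m.natDegree = t + 1) :
    (hankelSq K t (charSeq K m)).det = Equiv.Perm.sign (Fin.revPerm : Equiv.Perm (Fin (t + 1))) := by
  set U : Matrix (Fin (t + 1)) (Fin (t + 1)) K := (hankelSq K t (charSeq K m)).submatrix id Fin.revPerm with hU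
  have hback : hankelSq K t (charSeq K m) = U.submatrix id Fin.revPerm := by
    ext i j
    simp only [hU, Matrix.submatrix_apply, id, Fin.revPerm_apply, Fin.rev_rev]
  have hlow : U.BlockTriangular OrderDual.toDual := by
    intro i j hij
    have hij' : (i : ℕ) < j := hij
    have h := hankelSq_charSeq_apply_of_le K hm hmd i (Fin.rev j) (by rw [Fin.val_rev]; omega)
    rw [if_neg (by rw [Fin.val_rev]; omega)] at h
    simpa only [hU, Matrix.submatrix_apply, id, Fin.revPerm_apply] using h
  have hdiag : ∀ i : Fin (t + 1), U i i = 1 := fun i => by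
    have h := hankelSq_charSeq_apply_of_le K hm hmd i (Fin.rev i) (by rw [Fin.val_rev]; omega)
    rw [if_pos (by rw [Fin.val_rev]; omega)] at h
    simpa only [hU, Matrix.submatrix_apply, id, Fin.revPerm_apply] using h
  rw [hback, Matrix.det_permute', Matrix.det_of_lowerTriangular U hlow, Finset.prod_eq_one fun i _ => hdiag i, mul_one]

/-! ## §626. Barnett's factorisation `H(dualSeq m a) = H(charSeq m) · M_a` -/

/-- **`H(dualSeq m a) = H(charSeq m) · M_a`** (`m` monic of degree `t + 1`): `Σ_k charSeq(i + k) · [X^k](X^j a mod m) = ⟪X^j a mod m, charSeq m⟫_i = dualSeq m (X^j a) i = dualSeq m a (i + j)`. -/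
theorem hankelSq_dualSeq_eq_mul {t : ℕ} {m : K[X]} (hm : m.Monic) (hmd : m.natDegree = t + 1) (a : K[X]) :
    hankelSq K t (dualSeq K m a) = hankelSq K t (charSeq K m) * mulResidueMat K t m a := by
  ext i j
  have hm1 : m ≠ 1 := fun h => by rw [h, Polynomial.natDegree_one] at hmd; omega
  have hdeg : (Polynomial.X ^ (j : ℕ) * a %ₘ m).natDegree < t + 1 := (Polynomial.natDegree_modByMonic_lt _ hm hm1).trans_eq hmd
  rw [Matrix.mul_apply, hankelSq, Matrix.of_apply]
  calc dualSeq K m a ((i : ℕ) + j) = dualSeq K m (Polynomial.X ^ (j : ℕ) * a) i := (dualSeq_X_pow_mul K m a j i).symm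
    _ = dualSeq K m (Polynomial.X ^ (j : ℕ) * a %ₘ m) i := (congrFun (dualSeq_modByMonic K hm _) i).symm
    _ = hkFun K (charSeq K m) i (Polynomial.X ^ (j : ℕ) * a %ₘ m) := dualSeq_eq_hkFun_charSeq K m _ i
    _ = ∑ k ∈ Finset.range (t + 1), (Polynomial.X ^ (j : ℕ) * a %ₘ m).coeff k * charSeq K m (k + i) := hkFun_eq_sum_range K _ _ hdeg
    _ = ∑ k : Fin (t + 1), Matrix.of (fun i j : Fin (t + 1) => charSeq K m ((i : ℕ) + j)) i k * mulResidueMat K t m a k j := by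
        rw [← Fin.sum_univ_eq_sum_range]
        exact Finset.sum_congr rfl fun k _ => by rw [Matrix.of_apply, mulResidueMat_apply, add_comm (k : ℕ), mul_comm]

/-- **`det H(dualSeq m a) = sign(reversal) · det M_a`.** -/
theorem det_hankelSq_dualSeq {t : ℕ} {m : K[X]} (hm : m.Monic) (hmd : m.natDegree = t + 1) (a : K[X]) :
    (hankelSq K t (dualSeq K m a)).det = Equiv.Perm.sign (Fin.revPerm : Equiv.Perm (Fin (t + 1))) * (mulResidueMat K t m a).det := by
  rw [hankelSq_dualSeq_eq_mul K hm hmd, Matrix.det_mul, det_hankelSq_charSeq K hm hmd]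

/-! ## §627. Non-vanishing: `det H(dualSeq m a) ≠ 0 ⟺ gcd(m, a) = 1` -/

/-- **`det H(dualSeq m a) ≠ 0 ⟺ IsCoprime m a`** (`m` monic of degree `t + 1`): the left kernel of `H^{2t}_t(dualSeq m a)` is `{p : deg p ≤ t, m ∣ p·a}` (N32), which is `0` iff `a` is prime
to `m` (a non-trivial common factor `g` gives the kernel vector `m/g`, N32). -/
theorem det_hankelSq_dualSeq_ne_zero_iff [DecidableEq K] {t : ℕ} {m : K[X]} (hm : m.Monic) (hmd : m.natDegree = t + 1) (a : K[X]) :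
    (hankelSq K t (dualSeq K m a)).det ≠ 0 ↔ IsCoprime m a := by
  rw [← rank_hankelSq_eq_iff_det_ne_zero]
  constructor
  · intro h
    have h' : (hankel1 K (2 * t) (2 * t / 2) (dualSeq K m a)).rank = t + 1 := by rw [← rank_hankelSq]; exact h
    by_contra hcop
    have hlt := rank_hankel1_half_dualSeq_lt_of_not_isCoprime K (N := 2 * t) hm hcop
    rw [h', hmd] at hlt
    exact lt_irrefl _ hlt
  · intro hcop
    -- the recurrence space `Rec^{2t}_t` is zero: a member `p` has `deg p ≤ t`, `m ∣ p a`, hence `m ∣ p`, hence `p = 0`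
    have hbot : recSpace K (2 * t) (dualSeq K m a) t = ⊥ := by
      rw [Submodule.eq_bot_iff]
      intro p hp
      obtain ⟨hpdeg, hdvd⟩ := (mem_recSpace_dualSeq_iff K (N := 2 * t) hm a (k := t) (by omega) p).mp hp
      have hmp : m ∣ p := hcop.dvd_of_dvd_mul_right hdvd
      by_contra hp0
      have h1 := Polynomial.natDegree_le_of_dvd hmp hp0
      have h2 := (mem_degreeLT_succ_iff K).mp hpdeg
      omega
    have h := finrank_recSpace_add_rank K (N := 2 * t) t (dualSeq K m a)
    rw [hbot, finrank_bot, zero_add] at h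
    rw [hankelSq_eq_submatrix, show (id : Fin (t + 1) → Fin (t + 1)) = (Equiv.refl (Fin (t + 1)) : Fin (t + 1) → Fin (t + 1)) from rfl, Matrix.rank_submatrix]
    exact h

/-- **`det M_a ≠ 0 ⟺ IsCoprime m a`** (`m` monic of degree `t + 1`). -/
theorem det_mulResidueMat_ne_zero_iff [DecidableEq K] {t : ℕ} {m : K[X]} (hm : m.Monic) (hmd : m.natDegree = t + 1) (a : K[X]) :
    (mulResidueMat K t m a).det ≠ 0 ↔ IsCoprime m a := by
  rw [← det_hankelSq_dualSeq_ne_zero_iff K hm hmd a, det_hankelSq_dualSeq K hm hmd]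
  have hs : ((Equiv.Perm.sign (Fin.revPerm : Equiv.Perm (Fin (t + 1))) : ℤ) : K) ≠ 0 := by
    rcases Int.units_eq_one_or (Equiv.Perm.sign (Fin.revPerm : Equiv.Perm (Fin (t + 1)))) with h | h <;> rw [h] <;> simp
  rw [mul_ne_zero_iff, and_iff_right hs]

/-! ## §628. `det M_a` is the norm of `a` in `K[X]/(m)` -/

/-- the `j`-th vector of the power basis of `AdjoinRoot m` is `mk (X^j)`. -/
theorem powerBasisAux'_apply {m : K[X]} (hm : m.Monic) (j : Fin m.natDegree) : AdjoinRoot.powerBasisAux' hm j = AdjoinRoot.mk m (Polynomial.X ^ (j : ℕ)) := by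
  classical
  rw [← Basis.repr_symm_single_one, AdjoinRoot.powerBasisAux'_repr_symm_apply]
  congr 1
  rw [Finset.sum_eq_single j (fun i _ hi => by rw [Finsupp.single_apply, if_neg (Ne.symm hi), Polynomial.monomial_zero_right]) (fun h => absurd (Finset.mem_univ j) h),
    Finsupp.single_apply, if_pos rfl, Polynomial.monomial_one_right_eq_X_pow]

/-- **`M_a` IS THE MATRIX OF MULTIPLICATION BY `a` ON `K[X]/(m)` in the power basis `1, x, …, x^t`** (reindexed along `deg m = t + 1`). -/
theorem reindex_leftMulMatrix_eq_mulResidueMat {t : ℕ} {m : K[X]} (hm : m.Monic) (hmd : m.natDegree = t + 1) (a : K[X]) :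
    Matrix.reindex (finCongr hmd) (finCongr hmd) (Algebra.leftMulMatrix (AdjoinRoot.powerBasisAux' hm) (AdjoinRoot.mk m a)) = mulResidueMat K t m a := by
  ext k j
  rw [Matrix.reindex_apply, Matrix.submatrix_apply, mulResidueMat_apply, Algebra.leftMulMatrix_eq_repr_mul, AdjoinRoot.powerBasisAux'_repr_apply_to_fun, powerBasisAux'_apply,
    ← map_mul, AdjoinRoot.modByMonicHom_mk, mul_comm]
  simp only [finCongr_symm, finCongr_apply, Fin.val_cast]

/-- **`det M_a = N_{K[X]/(m) ∕ K}(a)`: the determinant of the multiplication matrix is the NORM of the residue of `a` in `AdjoinRoot m = K[X]/(m)`** (`m` monic of degree `t + 1`). -/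
theorem det_mulResidueMat_eq_norm {t : ℕ} {m : K[X]} (hm : m.Monic) (hmd : m.natDegree = t + 1) (a : K[X]) :
    (mulResidueMat K t m a).det = Algebra.norm K (AdjoinRoot.mk m a) := by
  classical
  rw [← reindex_leftMulMatrix_eq_mulResidueMat K hm hmd a, Matrix.det_reindex_self, Algebra.norm_eq_matrix_det (AdjoinRoot.powerBasisAux' hm)]

/-- **KRONECKER–HERMITE: `det (dualSeq m a (i + j))_{i,j ≤ t} = sign(reversal) · N_{K[X]/(m) ∕ K}(a)`** for `m` monic of degree `t + 1` (the norm is the resultant `Res(m, a)`, dictionary only). -/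
theorem det_hankelSq_dualSeq_eq_sign_mul_norm {t : ℕ} {m : K[X]} (hm : m.Monic) (hmd : m.natDegree = t + 1) (a : K[X]) :
    (hankelSq K t (dualSeq K m a)).det = Equiv.Perm.sign (Fin.revPerm : Equiv.Perm (Fin (t + 1))) * Algebra.norm K (AdjoinRoot.mk m a) := by
  rw [det_hankelSq_dualSeq K hm hmd, det_mulResidueMat_eq_norm K hm hmd]

/-- **`N_{K[X]/(m) ∕ K}(a) ≠ 0 ⟺ gcd(m, a) = 1`** (read off the Hankel determinant, §627). -/
theorem norm_adjoinRoot_mk_ne_zero_iff [DecidableEq K] {t : ℕ} {m : K[X]} (hm : m.Monic) (hmd : m.natDegree = t + 1) (a : K[X]) :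
    Algebra.norm K (AdjoinRoot.mk m a) ≠ 0 ↔ IsCoprime m a := by
  rw [← det_mulResidueMat_eq_norm K hm hmd, det_mulResidueMat_ne_zero_iff K hm hmd]

end Summit.Ventures.HSemireg.Wedge.HankelOuter
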